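import Mathlib
import Summits.NavierStokesRegularity.NavierStokesRegularity.Theorems.EulerZoomLiouvillePowerGaugeEulerLiouvilleSelfSimilarBernoulliLandscape
import HarnessLib.Audit

/-!
# Needle portrait: LABEL INTEGRATION of the feeding law (ROUND-37 (F), second half) — Tonelli over
# labels × similarity time, the exact Jacobian `e^{3γs}` on STAY windows, Cauchy–Schwarz across labels
# (helper of the crux `EulerZoomLiouville.PowerGaugeEulerLiouville`, route №10, item stmt-NavierStokesRegularity-19832)

Helper file (`--supports stmt-NavierStokesRegularity-19832`; one definition, `stayTube`). Text custody
nsreg-p2 (`HOME/ns-regularity-ideate-p2/ROUND-37.md` §2 (3)). Third file of the feeding side (F), after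
`…NeedleRiseLemma` and `…NeedleFeedingPerLabel`; independent of both (the per-label law is a hypothesis).

SETTING (the LEAD lineage's cut-off idiom). `V ∈ C²`, `‖DV‖ ≤ K`, divergence-free on `‖z‖ ≤ L`;
`Ψ_s = ODE.evolutionMap (fun _ => selfSimilarTransport γ 0 V) 0 s` the global `C²` flow of `γy + V`
(`…SelfSimilarKelvinFlowC2`); backward orbit of a label `y`: `s ↦ Ψ_{−s} y`;
`stayTube γ V L N := {(y,s) : (∀ σ ∈ [0,s], ‖Ψ_{−σ} y‖ ≤ L) ∧ Ψ_{−s} y ∈ N}`.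
* `measurableSet_stayTube` (rational stay times + endpoint); `section_subset_image_flow` —
  `{y : (y,s) ∈ stayTube} ⊆ Ψ_s(N ∩ {forward stay})`: NO hitting times, so the LEAD's exact Jacobian
  (`BernoulliLandscape.det_fderiv_flow_eq_exp_of_stay`) applies; `lintegral_section_le` —
  `∫_{(y,s) ∈ stayTube} w(Ψ_{−s}y) dy ≤ e^{3γs} ∫_N w` (area formula); `lintegral_labels_le` — Tonelli:
  `∫_X ∫_{[0,S]} 1_{stayTube} w(Ψ_{−s}y) ≤ c_S ∫_N w`, `c_S = (e^{3γS} − 1)/(3γ)`;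
* `mul_measure_le_rpow_mul_rpow` (Cauchy–Schwarz across labels), `ofReal_integral_label_eq` (real
  label integrals = `ℝ≥0∞` stay-tube integrals);
* **`ofReal_mul_volume_le_feeding`** — THE LABEL-INTEGRATED FEEDING LAW: the per-label law (conclusion of
  `NeedleFeeding.volume_toReal_le_feeding_of_exit`, constant `g = |G|/(4R)`) on every `y ∈ X` ⇒
  `g·|X| ≤ √(c_S|N|)·√(c_S ∫_N‖V‖²)`; with `g ≥ R/4` this is ROUND-37 (F):
  `|X_S| ≤ (4/R)·c_S·√(|N(R)|·∫_{N(R)}‖V‖²)`.  NOT here: Lemma K, the race.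

References: Constantin–Ignatova–Vicol arXiv:2602.17570 §3.4.1 (3.21)–(3.22) (flow, Jacobian)
[ConstantinIgnatovaVicol2026Putative]; (Tonelli, area formula, Cauchy–Schwarz) [folklore].
-/

noncomputable section

-- the summit and its single problem share the name `NavierStokesRegularity` (D-0017 nested layout)
set_option linter.dupNamespace false

open Set Filter Topology Metric Function MeasureTheory InnerProductSpace
open scoped RealInnerProductSpace NNReal ENNReal

namespace Summit.NavierStokesRegularity.NavierStokesRegularity.Theorems.PowerGaugeEulerLiouville.NeedleFeeding

open Literature.Analysis Literature.Analysis.FluidPDE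
open Summit.NavierStokesRegularity.NavierStokesRegularity.Theorems.PowerGaugeEulerLiouville.Kelvin
open Summit.NavierStokesRegularity.NavierStokesRegularity.Theorems.PowerGaugeEulerLiouville.BernoulliLandscape

variable {γ : ℝ} {V : (EuclideanSpace ℝ (Fin 3)) → (EuclideanSpace ℝ (Fin 3))} {K L : ℝ}
  {N : Set (EuclideanSpace ℝ (Fin 3))}

/-! ### Flow bookkeeping -/

/-- The flow `(s, y) ↦ Ψ_s y` of `γy + V` (`V ∈ C²`, `‖DV‖ ≤ K`) is jointly continuous. [cite: ConstantinIgnatovaVicol2026Putative, §3.4.1 eq. (3.21)] -/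
theorem continuous_flow_uncurry (hV : ContDiff ℝ 2 V) (hK : ∀ y, ‖fderiv ℝ V y‖ ≤ K) :
    Continuous fun p : ℝ × EuclideanSpace ℝ (Fin 3) =>
      ODE.evolutionMap (fun _ : ℝ => selfSimilarTransport γ 0 V) 0 p.1 p.2 :=
  (C2.Kelvin.contDiff_flow_uncurry (γ := γ) hV hK).continuous

/-- `s ↦ Ψ_s y` at a fixed label is continuous. [cite: ConstantinIgnatovaVicol2026Putative, §3.4.1 eq. (3.21)] -/
theorem continuous_flow_time (hV : ContDiff ℝ 2 V) (hK : ∀ y, ‖fderiv ℝ V y‖ ≤ K)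
    (y : EuclideanSpace ℝ (Fin 3)) :
    Continuous fun s : ℝ => ODE.evolutionMap (fun _ : ℝ => selfSimilarTransport γ 0 V) 0 s y :=
  (continuous_flow_uncurry (γ := γ) hV hK).comp (Continuous.prodMk_left y)

/-- The backward-orbit map `(y, s) ↦ Ψ_{−s} y` is jointly continuous. [cite: ConstantinIgnatovaVicol2026Putative, §3.4.1 eq. (3.21)] -/
theorem continuous_backflow (hV : ContDiff ℝ 2 V) (hK : ∀ y, ‖fderiv ℝ V y‖ ≤ K) :
    Continuous fun p : EuclideanSpace ℝ (Fin 3) × ℝ =>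
      ODE.evolutionMap (fun _ : ℝ => selfSimilarTransport γ 0 V) 0 (-p.2) p.1 :=
  (continuous_flow_uncurry (γ := γ) hV hK).comp (continuous_snd.neg.prodMk continuous_fst)

/-- `Ψ_{−s}(Ψ_s z) = z`. [folklore] -/
theorem flow_neg_flow (hV : ContDiff ℝ 1 V) (hK : ∀ y, ‖fderiv ℝ V y‖ ≤ K) (s : ℝ)
    (z : EuclideanSpace ℝ (Fin 3)) :
    ODE.evolutionMap (fun _ : ℝ => selfSimilarTransport γ 0 V) 0 (-s)
      (ODE.evolutionMap (fun _ : ℝ => selfSimilarTransport γ 0 V) 0 s z) = z := by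
  rw [← C2.Kelvin.flow_add (γ := γ) hV hK, neg_add_cancel]
  exact ODE.evolutionMap_self _ 0 z

/-- `Ψ_σ(Ψ_{−s} y) = Ψ_{−(s−σ)} y`. [folklore] -/
theorem flow_flow_neg_eq (hV : ContDiff ℝ 1 V) (hK : ∀ y, ‖fderiv ℝ V y‖ ≤ K) (σ s : ℝ)
    (y : EuclideanSpace ℝ (Fin 3)) :
    ODE.evolutionMap (fun _ : ℝ => selfSimilarTransport γ 0 V) 0 σ
      (ODE.evolutionMap (fun _ : ℝ => selfSimilarTransport γ 0 V) 0 (-s) y) =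
      ODE.evolutionMap (fun _ : ℝ => selfSimilarTransport γ 0 V) 0 (-(s - σ)) y := by
  rw [← C2.Kelvin.flow_add (γ := γ) hV hK]
  congr 1; ring

/-! ### The stay-tube set -/

/-- **The stay-tube set** of a tube `N` at radius `L`:
`stayTube γ V L N = {(y, s) : (∀ σ ∈ [0,s], ‖Ψ_{−σ} y‖ ≤ L) ∧ Ψ_{−s} y ∈ N}`. [folklore] -/
def stayTube (γ : ℝ) (V : EuclideanSpace ℝ (Fin 3) → EuclideanSpace ℝ (Fin 3)) (L : ℝ)
    (N : Set (EuclideanSpace ℝ (Fin 3))) : Set (EuclideanSpace ℝ (Fin 3) × ℝ) :=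
  {p | (∀ σ ∈ Icc 0 p.2, ‖ODE.evolutionMap (fun _ : ℝ => selfSimilarTransport γ 0 V) 0 (-σ) p.1‖ ≤ L) ∧
    ODE.evolutionMap (fun _ : ℝ => selfSimilarTransport γ 0 V) 0 (-p.2) p.1 ∈ N}

/-- The label section of the stay-tube set is the per-label set of `…NeedleFeedingPerLabel`
(with `Y s = Ψ_{−s} y`). [folklore] -/
theorem labelSection_stayTube (y : EuclideanSpace ℝ (Fin 3)) :
    {s : ℝ | (y, s) ∈ stayTube γ V L N} =
      {s : ℝ | ∀ σ ∈ Icc 0 s, ‖ODE.evolutionMap (fun _ : ℝ => selfSimilarTransport γ 0 V) 0 (-σ) y‖ ≤ L} ∩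
        (fun s => ODE.evolutionMap (fun _ : ℝ => selfSimilarTransport γ 0 V) 0 (-s) y) ⁻¹' N :=
  rfl

/-- **Measurability of the stay-tube set**: the stay condition is tested at rational times
(continuity of the orbit) plus the endpoint. [folklore] -/
theorem measurableSet_stayTube (hV : ContDiff ℝ 2 V) (hK : ∀ y, ‖fderiv ℝ V y‖ ≤ K) (L : ℝ)
    (hNm : MeasurableSet N) : MeasurableSet (stayTube γ V L N) := by
  have hΘ := continuous_backflow (γ := γ) hV hK
  -- `stayTube = (⋂_q rational stay test) ∩ (endpoint test) ∩ (tube test)`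
  have heq : stayTube γ V L N =
      (⋂ q : ℚ, ({p : EuclideanSpace ℝ (Fin 3) × ℝ | (q : ℝ) < 0} ∪ {p | p.2 < q} ∪
        {p | ‖ODE.evolutionMap (fun _ : ℝ => selfSimilarTransport γ 0 V) 0 (-(q : ℝ)) p.1‖ ≤ L})) ∩
      ({p : EuclideanSpace ℝ (Fin 3) × ℝ | p.2 < 0} ∪
        {p | ‖ODE.evolutionMap (fun _ : ℝ => selfSimilarTransport γ 0 V) 0 (-p.2) p.1‖ ≤ L}) ∩
      {p | ODE.evolutionMap (fun _ : ℝ => selfSimilarTransport γ 0 V) 0 (-p.2) p.1 ∈ N} := by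
    ext p
    simp only [stayTube, mem_inter_iff, mem_iInter, mem_union, mem_setOf_eq]
    constructor
    · rintro ⟨hst, hN⟩
      refine ⟨⟨fun q => ?_, ?_⟩, hN⟩
      · by_cases h1 : (q : ℝ) < 0
        · exact Or.inl (Or.inl h1)
        · by_cases h2 : p.2 < q
          · exact Or.inl (Or.inr h2)
          · exact Or.inr (hst q ⟨not_lt.1 h1, not_lt.1 h2⟩)
      · by_cases h0 : p.2 < 0
        · exact Or.inl h0
        · exact Or.inr (hst p.2 ⟨not_lt.1 h0, le_rfl⟩)
    · rintro ⟨⟨hQ', hC'⟩, hN⟩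
      refine ⟨fun σ hσ => ?_, hN⟩
      rcases eq_or_lt_of_le hσ.2 with hσeq | hσlt
      · rcases hC' with h0 | h
        · exact absurd (hσ.1.trans hσ.2) (not_le.2 h0)
        · rw [hσeq]; exact h
      · -- `σ < p.2`: continuity through rational times in `(σ, p.2)`
        by_contra hgt
        push Not at hgt
        have hcont : Continuous fun τ : ℝ =>
            ‖ODE.evolutionMap (fun _ : ℝ => selfSimilarTransport γ 0 V) 0 (-τ) p.1‖ :=
          ((continuous_flow_time (γ := γ) hV hK p.1).comp continuous_neg).norm
        obtain ⟨ε, hε, hball⟩ :=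
          Metric.eventually_nhds_iff.1 (hcont.continuousAt.eventually (lt_mem_nhds hgt))
        obtain ⟨q, hq1, hq2⟩ := exists_rat_btwn (lt_min hσlt (lt_add_of_pos_right σ hε))
        have hqσ : σ < q := hq1
        have hq_ball : dist (q : ℝ) σ < ε := by
          rw [Real.dist_eq, abs_of_pos (sub_pos.2 hqσ)]
          linarith [hq2.trans_le (min_le_right _ _)]
        rcases hQ' q with (h | h) | h
        · exact absurd (hσ.1.trans_lt hqσ) (not_lt.2 h.le)
        · exact absurd (hq2.trans_le (min_le_left _ _)) (not_lt.2 h.le)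
        · exact absurd h (not_le.2 (hball hq_ball))
  rw [heq]
  refine ((MeasurableSet.iInter fun q => ?_).inter
    ((measurableSet_lt measurable_snd measurable_const).union
      (measurableSet_le hΘ.norm.measurable measurable_const))).inter (hNm.preimage hΘ.measurable)
  refine (MeasurableSet.union ?_ (measurableSet_lt measurable_snd measurable_const)).union
    (measurableSet_le ((continuous_flow_uncurry (γ := γ) hV hK).comp
      (continuous_const.prodMk continuous_fst)).norm.measurable measurable_const)
  by_cases h : (q : ℝ) < 0
  · simp only [h, setOf_true]; exact MeasurableSet.univ
  · simp only [h, setOf_false]; exact MeasurableSet.empty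

/-- Measurability of a stay-tube density `1_{stayTube}·w(Ψ_{−s}y)`. [folklore] -/
theorem measurable_indicator_stayTube (hV : ContDiff ℝ 2 V) (hK : ∀ y, ‖fderiv ℝ V y‖ ≤ K) (L : ℝ)
    (hNm : MeasurableSet N) {w : EuclideanSpace ℝ (Fin 3) → ℝ≥0∞} (hw : Measurable w) :
    Measurable ((stayTube γ V L N).indicator fun p =>
      w (ODE.evolutionMap (fun _ : ℝ => selfSimilarTransport γ 0 V) 0 (-p.2) p.1)) :=
  (hw.comp (continuous_backflow (γ := γ) hV hK).measurable).indicator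
    (measurableSet_stayTube (γ := γ) hV hK L hNm)

/-! ### Sections at a fixed time are forward images of staying tube points -/

/-- The forward-stay set `{z : ∀ σ ∈ [0,s], ‖Ψ_σ z‖ ≤ L}` is closed. [folklore] -/
theorem isClosed_forwardStay (hV : ContDiff ℝ 2 V) (hK : ∀ y, ‖fderiv ℝ V y‖ ≤ K) (s L : ℝ) :
    IsClosed {z : EuclideanSpace ℝ (Fin 3) |
      ∀ σ ∈ Icc 0 s, ‖ODE.evolutionMap (fun _ : ℝ => selfSimilarTransport γ 0 V) 0 σ z‖ ≤ L} := by
  have heq : {z : EuclideanSpace ℝ (Fin 3) |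
      ∀ σ ∈ Icc 0 s, ‖ODE.evolutionMap (fun _ : ℝ => selfSimilarTransport γ 0 V) 0 σ z‖ ≤ L} =
      ⋂ σ ∈ Icc (0 : ℝ) s,
        {z | ‖ODE.evolutionMap (fun _ : ℝ => selfSimilarTransport γ 0 V) 0 σ z‖ ≤ L} := by
    ext z; simp only [mem_setOf_eq, mem_iInter]
  rw [heq]
  refine isClosed_biInter fun σ _ => isClosed_le ?_ continuous_const
  exact ((continuous_flow_uncurry (γ := γ) hV hK).comp (Continuous.prodMk_right σ)).norm

/-- **No hitting times needed.** `{y : (y,s) ∈ stayTube} ⊆ Ψ_s(N ∩ {z : ∀σ∈[0,s], ‖Ψ_σ z‖ ≤ L})`.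
[folklore] -/
theorem section_subset_image_flow (hV : ContDiff ℝ 1 V) (hK : ∀ y, ‖fderiv ℝ V y‖ ≤ K) (s : ℝ) :
    {y : EuclideanSpace ℝ (Fin 3) | (y, s) ∈ stayTube γ V L N} ⊆
      ODE.evolutionMap (fun _ : ℝ => selfSimilarTransport γ 0 V) 0 s ''
        (N ∩ {z | ∀ σ ∈ Icc 0 s, ‖ODE.evolutionMap (fun _ : ℝ => selfSimilarTransport γ 0 V) 0 σ z‖ ≤ L}) := by
  rintro y ⟨hst, hN⟩
  refine ⟨ODE.evolutionMap (fun _ : ℝ => selfSimilarTransport γ 0 V) 0 (-s) y, ⟨hN, fun σ hσ => ?_⟩, ?_⟩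
  · rw [flow_flow_neg_eq (γ := γ) hV hK σ s y]
    exact hst (s - σ) ⟨sub_nonneg.2 hσ.2, sub_le_self _ hσ.1⟩
  · rw [flow_flow_neg_eq (γ := γ) hV hK s s y, sub_self, neg_zero]
    exact ODE.evolutionMap_self _ 0 y

/-- **Integral over a time section** (area formula with the constant Jacobian `e^{3γs}`, `s ≥ 0`):
`∫_{(y,s) ∈ stayTube} w(Ψ_{−s}y) dy ≤ e^{3γs} ∫_N w` (`w = 1`: `|{y : (y,s) ∈ stayTube}| ≤ e^{3γs}|N|`).
[cite: ConstantinIgnatovaVicol2026Putative, §3.4.1 eq. (3.22) (remark after)] -/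
theorem lintegral_section_le (hV : ContDiff ℝ 2 V) (hK : ∀ y, ‖fderiv ℝ V y‖ ≤ K) {s : ℝ} (hs : 0 ≤ s)
    (hdiv : ∀ z : EuclideanSpace ℝ (Fin 3), ‖z‖ ≤ L → VectorCalculus.divergence V z = 0)
    (hNm : MeasurableSet N) {w : EuclideanSpace ℝ (Fin 3) → ℝ≥0∞} (hw : Measurable w) :
    ∫⁻ y in {y : EuclideanSpace ℝ (Fin 3) | (y, s) ∈ stayTube γ V L N},
        w (ODE.evolutionMap (fun _ : ℝ => selfSimilarTransport γ 0 V) 0 (-s) y) ≤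
      ENNReal.ofReal (Real.exp (3 * γ * s)) * ∫⁻ z in N, w z := by
  have hV1 : ContDiff ℝ 1 V := hV.of_le (by norm_num)
  -- the staying part of the tube, `F = N ∩ {forward stay}`
  obtain ⟨F, hF⟩ : ∃ F : Set (EuclideanSpace ℝ (Fin 3)), F = N ∩ {z |
      ∀ σ ∈ Icc 0 s, ‖ODE.evolutionMap (fun _ : ℝ => selfSimilarTransport γ 0 V) 0 σ z‖ ≤ L} := ⟨_, rfl⟩
  have hFm : MeasurableSet F := hF ▸ hNm.inter (isClosed_forwardStay (γ := γ) hV hK s L).measurableSet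
  have hFN : F ⊆ N := hF ▸ inter_subset_left
  have hFst : ∀ z ∈ F, ∀ σ ∈ Icc 0 s,
      ‖ODE.evolutionMap (fun _ : ℝ => selfSimilarTransport γ 0 V) 0 σ z‖ ≤ L := fun z hz => (hF ▸ hz).2
  have hdiff : ∀ x ∈ F, HasFDerivWithinAt (ODE.evolutionMap (fun _ : ℝ => selfSimilarTransport γ 0 V) 0 s)
      (fderiv ℝ (ODE.evolutionMap (fun _ : ℝ => selfSimilarTransport γ 0 V) 0 s) x) F x := fun x _ =>
    (((C2.Kelvin.contDiff_flow (γ := γ) hV hK s).differentiable (by norm_num)) x).hasFDerivAt.hasFDerivWithinAt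
  have hinj : InjOn (ODE.evolutionMap (fun _ : ℝ => selfSimilarTransport γ 0 V) 0 s) F :=
    ((C2.Kelvin.isUniformlyLipschitzOn_transport (γ := γ) hV1 hK).bijective_evolutionMap convex_univ
      (mem_univ _) (mem_univ _)).injective.injOn
  calc _ ≤ ∫⁻ y in ODE.evolutionMap (fun _ : ℝ => selfSimilarTransport γ 0 V) 0 s '' F,
        w (ODE.evolutionMap (fun _ : ℝ => selfSimilarTransport γ 0 V) 0 (-s) y) :=
        lintegral_mono_set (hF ▸ section_subset_image_flow (γ := γ) hV1 hK s)
    _ = ∫⁻ z in F, ENNReal.ofReal |(fderiv ℝ (ODE.evolutionMap (fun _ : ℝ => selfSimilarTransport γ 0 V) 0 s) z).det| *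
          w (ODE.evolutionMap (fun _ : ℝ => selfSimilarTransport γ 0 V) 0 (-s)
            (ODE.evolutionMap (fun _ : ℝ => selfSimilarTransport γ 0 V) 0 s z)) :=
        lintegral_image_eq_lintegral_abs_det_fderiv_mul volume hFm hdiff hinj _
    _ = ∫⁻ z in F, ENNReal.ofReal (Real.exp (3 * γ * s)) * w z := by
        refine setLIntegral_congr_fun hFm (fun z hz => ?_)
        rw [det_fderiv_flow_eq_exp_of_stay (γ := γ) hV hK hs hdiv z (hFst z hz), abs_of_pos (Real.exp_pos _),
          flow_neg_flow (γ := γ) hV1 hK s z]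
    _ = ENNReal.ofReal (Real.exp (3 * γ * s)) * ∫⁻ z in F, w z := lintegral_const_mul _ hw
    _ ≤ ENNReal.ofReal (Real.exp (3 * γ * s)) * ∫⁻ z in N, w z := by gcongr

/-! ### Tonelli over labels × time -/

/-- `∫_{[0,S]} e^{3γs} ds = (e^{3γS} − 1)/(3γ)` (`γ > 0`, `S ≥ 0`), in `ℝ≥0∞`. [folklore] -/
theorem lintegral_exp_Icc (hγ : 0 < γ) {S : ℝ} (hS : 0 ≤ S) :
    ∫⁻ s in Icc 0 S, ENNReal.ofReal (Real.exp (3 * γ * s)) =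
      ENNReal.ofReal ((Real.exp (3 * γ * S) - 1) / (3 * γ)) := by
  have hc : Continuous fun s : ℝ => Real.exp (3 * γ * s) := by fun_prop
  have hint : IntegrableOn (fun s : ℝ => Real.exp (3 * γ * s)) (Icc 0 S) volume :=
    hc.continuousOn.integrableOn_compact isCompact_Icc
  rw [← ofReal_integral_eq_lintegral_ofReal hint (ae_of_all _ fun s => (Real.exp_pos _).le)]
  congr 1
  rw [integral_Icc_eq_integral_Ioc, ← intervalIntegral.integral_of_le hS]
  have hγ3 : (3 : ℝ) * γ ≠ 0 := by positivity
  have hderiv : ∀ x ∈ uIcc 0 S, HasDerivAt (fun s : ℝ => Real.exp (3 * γ * s) / (3 * γ))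
      (Real.exp (3 * γ * x)) x := by
    intro x _
    have h := (((hasDerivAt_id' x).const_mul (3 * γ)).exp).div_const (3 * γ)
    refine h.congr_deriv ?_
    field_simp
  rw [intervalIntegral.integral_eq_sub_of_hasDerivAt hderiv (hc.intervalIntegrable 0 S)]
  simp only [mul_zero, Real.exp_zero]
  ring

/-- **Tonelli with the Jacobian**: `∫_X ∫_{[0,S]} 1_{stayTube}(y,s)·w(Ψ_{−s}y) ds dy ≤ c_S·∫_N w`,
`c_S = (e^{3γS} − 1)/(3γ)`. [folklore] -/
theorem lintegral_labels_le (hV : ContDiff ℝ 2 V) (hK : ∀ y, ‖fderiv ℝ V y‖ ≤ K) (hγ : 0 < γ)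
    (hdiv : ∀ z : EuclideanSpace ℝ (Fin 3), ‖z‖ ≤ L → VectorCalculus.divergence V z = 0)
    (hNm : MeasurableSet N) {w : EuclideanSpace ℝ (Fin 3) → ℝ≥0∞} (hw : Measurable w)
    (X : Set (EuclideanSpace ℝ (Fin 3))) {S : ℝ} (hS : 0 ≤ S) :
    ∫⁻ y in X, ∫⁻ s in Icc 0 S, (stayTube γ V L N).indicator (fun p =>
        w (ODE.evolutionMap (fun _ : ℝ => selfSimilarTransport γ 0 V) 0 (-p.2) p.1)) (y, s) ≤
      ENNReal.ofReal ((Real.exp (3 * γ * S) - 1) / (3 * γ)) * ∫⁻ z in N, w z := by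
  have hm := measurable_indicator_stayTube (γ := γ) hV hK L hNm hw
  have h𝔈 := measurableSet_stayTube (γ := γ) hV hK L hNm
  rw [lintegral_lintegral_swap (f := fun y s => (stayTube γ V L N).indicator (fun p =>
      w (ODE.evolutionMap (fun _ : ℝ => selfSimilarTransport γ 0 V) 0 (-p.2) p.1)) (y, s))
    (hm.comp (measurable_fst.prodMk measurable_snd)).aemeasurable]
  have hexpm : Measurable fun s : ℝ => ENNReal.ofReal (Real.exp (3 * γ * s)) :=
    (by fun_prop : Continuous fun s : ℝ => Real.exp (3 * γ * s)).measurable.ennreal_ofReal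
  set Ψ := ODE.evolutionMap (fun _ : ℝ => selfSimilarTransport γ 0 V) 0 with hΨ
  set T := stayTube γ V L N with hT
  calc ∫⁻ s in Icc 0 S, ∫⁻ y in X, T.indicator (fun p => w (Ψ (-p.2) p.1)) (y, s)
      ≤ ∫⁻ s in Icc 0 S, ENNReal.ofReal (Real.exp (3 * γ * s)) * ∫⁻ z in N, w z := by
        refine setLIntegral_mono' measurableSet_Icc (fun s hs => ?_)
        have hDm : MeasurableSet {y : EuclideanSpace ℝ (Fin 3) | (y, s) ∈ T} := measurable_prodMk_right h𝔈
        calc ∫⁻ y in X, T.indicator (fun p => w (Ψ (-p.2) p.1)) (y, s)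
            ≤ ∫⁻ y, T.indicator (fun p => w (Ψ (-p.2) p.1)) (y, s) := setLIntegral_le_lintegral _ _
          _ = ∫⁻ y, {y : EuclideanSpace ℝ (Fin 3) | (y, s) ∈ T}.indicator (fun y => w (Ψ (-s) y)) y := by
              refine lintegral_congr fun y => ?_
              by_cases hy : (y, s) ∈ T
              · rw [indicator_of_mem hy, indicator_of_mem (show y ∈ {y | (y, s) ∈ T} from hy)]
              · rw [indicator_of_notMem hy, indicator_of_notMem (show y ∉ {y | (y, s) ∈ T} from hy)]
          _ = ∫⁻ y in {y : EuclideanSpace ℝ (Fin 3) | (y, s) ∈ T}, w (Ψ (-s) y) := lintegral_indicator hDm _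
          _ ≤ ENNReal.ofReal (Real.exp (3 * γ * s)) * ∫⁻ z in N, w z :=
              lintegral_section_le (γ := γ) hV hK hs.1 hdiv hNm hw
    _ = (∫⁻ s in Icc 0 S, ENNReal.ofReal (Real.exp (3 * γ * s))) * ∫⁻ z in N, w z :=
        lintegral_mul_const _ hexpm
    _ = ENNReal.ofReal ((Real.exp (3 * γ * S) - 1) / (3 * γ)) * ∫⁻ z in N, w z := by
        rw [lintegral_exp_Icc hγ hS]

/-! ### Cauchy–Schwarz across labels and the per-label law in `ℝ≥0∞` -/

/-- **Cauchy–Schwarz across labels**: if `a ≤ F(y)^{1/2}·H(y)^{1/2}` for every `y ∈ X` then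
`a·|X| ≤ (∫_X F)^{1/2}·(∫_X H)^{1/2}`. [folklore] -/
theorem mul_measure_le_rpow_mul_rpow {α : Type*} [MeasurableSpace α] {μ : Measure α} {X : Set α}
    (hXm : MeasurableSet X) {F H : α → ℝ≥0∞} (hFm : Measurable F) (hHm : Measurable H) {a : ℝ≥0∞}
    (hlab : ∀ y ∈ X, a ≤ F y ^ (1 / 2 : ℝ) * H y ^ (1 / 2 : ℝ)) :
    a * μ X ≤ (∫⁻ y in X, F y ∂μ) ^ (1 / 2 : ℝ) * (∫⁻ y in X, H y ∂μ) ^ (1 / 2 : ℝ) := by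
  have hpow : ∀ x : ℝ≥0∞, (x ^ (1 / 2 : ℝ)) ^ (2 : ℝ) = x := fun x => by
    rw [← ENNReal.rpow_mul]; norm_num
  calc a * μ X = ∫⁻ _ in X, a ∂μ := by rw [setLIntegral_const]
    _ ≤ ∫⁻ y in X, F y ^ (1 / 2 : ℝ) * H y ^ (1 / 2 : ℝ) ∂μ := setLIntegral_mono' hXm hlab
    _ = ∫⁻ y in X, ((fun y => F y ^ (1 / 2 : ℝ)) * fun y => H y ^ (1 / 2 : ℝ)) y ∂μ := rfl
    _ ≤ (∫⁻ y in X, (F y ^ (1 / 2 : ℝ)) ^ (2 : ℝ) ∂μ) ^ (1 / (2 : ℝ)) *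
          (∫⁻ y in X, (H y ^ (1 / 2 : ℝ)) ^ (2 : ℝ) ∂μ) ^ (1 / (2 : ℝ)) :=
        ENNReal.lintegral_mul_le_Lp_mul_Lq _ Real.HolderConjugate.two_two
          (hFm.pow_const _).aemeasurable (hHm.pow_const _).aemeasurable
    _ = (∫⁻ y in X, F y ∂μ) ^ (1 / 2 : ℝ) * (∫⁻ y in X, H y ∂μ) ^ (1 / 2 : ℝ) := by
        simp_rw [hpow]

/-- A real label-section integral `∫_{[0,S]} 1_E(s)·w(Ψ_{−s}y) ds` (`w ≥ 0` continuous) is the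
`ℝ≥0∞` stay-tube integral `∫⁻_{[0,S]} 1_{stayTube}(y,s)·ofReal (w(Ψ_{−s}y))`. [folklore] -/
theorem ofReal_integral_label_eq (hV : ContDiff ℝ 2 V) (hK : ∀ y, ‖fderiv ℝ V y‖ ≤ K)
    (hNm : MeasurableSet N) (y : EuclideanSpace ℝ (Fin 3)) (S : ℝ) {w : EuclideanSpace ℝ (Fin 3) → ℝ}
    (hw : Continuous w) (hw0 : ∀ z, 0 ≤ w z) :
    ENNReal.ofReal (∫ s in Icc 0 S,
      ({s : ℝ | ∀ σ ∈ Icc 0 s, ‖ODE.evolutionMap (fun _ : ℝ => selfSimilarTransport γ 0 V) 0 (-σ) y‖ ≤ L} ∩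
        (fun s => ODE.evolutionMap (fun _ : ℝ => selfSimilarTransport γ 0 V) 0 (-s) y) ⁻¹' N).indicator
          (fun s => w (ODE.evolutionMap (fun _ : ℝ => selfSimilarTransport γ 0 V) 0 (-s) y)) s) =
      ∫⁻ s in Icc 0 S, (stayTube γ V L N).indicator (fun p =>
        ENNReal.ofReal (w (ODE.evolutionMap (fun _ : ℝ => selfSimilarTransport γ 0 V) 0 (-p.2) p.1))) (y, s) := by
  rw [← labelSection_stayTube (γ := γ) (V := V) (L := L) (N := N) y]
  have hEm : MeasurableSet {s : ℝ | (y, s) ∈ stayTube γ V L N} :=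
    measurable_prodMk_left (measurableSet_stayTube (γ := γ) hV hK L hNm)
  have hc : Continuous fun s : ℝ => w (ODE.evolutionMap (fun _ : ℝ => selfSimilarTransport γ 0 V) 0 (-s) y) :=
    hw.comp ((continuous_flow_time (γ := γ) hV hK y).comp continuous_neg)
  have hnn : ∀ s, 0 ≤ {s : ℝ | (y, s) ∈ stayTube γ V L N}.indicator (fun s =>
      w (ODE.evolutionMap (fun _ : ℝ => selfSimilarTransport γ 0 V) 0 (-s) y)) s := fun s =>
    Set.indicator_nonneg (fun _ _ => hw0 _) _
  rw [ofReal_integral_eq_lintegral_ofReal ((hc.continuousOn.integrableOn_compact isCompact_Icc).indicator hEm)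
    (ae_of_all _ hnn)]
  refine lintegral_congr fun s => ?_
  by_cases hs : (y, s) ∈ stayTube γ V L N
  · rw [Set.indicator_of_mem (show s ∈ {s : ℝ | (y, s) ∈ stayTube γ V L N} from hs), Set.indicator_of_mem hs]
  · rw [Set.indicator_of_notMem (show s ∉ {s : ℝ | (y, s) ∈ stayTube γ V L N} from hs),
      Set.indicator_of_notMem hs, ENNReal.ofReal_zero]

/-! ### The label-integrated feeding law -/

/-- **THE LABEL-INTEGRATED FEEDING LAW (ROUND-37 (F)).** `V ∈ C²`, `‖DV‖ ≤ K`, divergence-free on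
`‖z‖ ≤ L`, `γ > 0`, `S ≥ 0`, `N` and `X` measurable. If every label `y ∈ X` obeys the per-label law
(`NeedleFeeding.volume_toReal_le_feeding_of_exit` with `Y s = Ψ_{−s} y` and `g = |G|/(4R)`), then
`g·|X| ≤ √(c_S·|N|)·√(c_S·∫_N‖V‖²)`, `c_S = (e^{3γS} − 1)/(3γ)`.
[cite: ConstantinIgnatovaVicol2026Putative, §3.4.1 eq. (3.22) (remark after)] -/
theorem ofReal_mul_volume_le_feeding (hV : ContDiff ℝ 2 V) (hK : ∀ y, ‖fderiv ℝ V y‖ ≤ K)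
    (hγ : 0 < γ) (hdiv : ∀ z : EuclideanSpace ℝ (Fin 3), ‖z‖ ≤ L → VectorCalculus.divergence V z = 0)
    (hNm : MeasurableSet N) {X : Set (EuclideanSpace ℝ (Fin 3))} (hXm : MeasurableSet X)
    {S : ℝ} (hS : 0 ≤ S) {g : ℝ}
    (hlabel : ∀ y ∈ X, g ≤
      Real.sqrt (∫ s in Icc 0 S,
        ({s : ℝ | ∀ σ ∈ Icc 0 s, ‖ODE.evolutionMap (fun _ : ℝ => selfSimilarTransport γ 0 V) 0 (-σ) y‖ ≤ L} ∩
          (fun s => ODE.evolutionMap (fun _ : ℝ => selfSimilarTransport γ 0 V) 0 (-s) y) ⁻¹' N).indicator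
            (fun _ => (1 : ℝ)) s) *
      Real.sqrt (∫ s in Icc 0 S,
        ({s : ℝ | ∀ σ ∈ Icc 0 s, ‖ODE.evolutionMap (fun _ : ℝ => selfSimilarTransport γ 0 V) 0 (-σ) y‖ ≤ L} ∩
          (fun s => ODE.evolutionMap (fun _ : ℝ => selfSimilarTransport γ 0 V) 0 (-s) y) ⁻¹' N).indicator
            (fun s => ‖V (ODE.evolutionMap (fun _ : ℝ => selfSimilarTransport γ 0 V) 0 (-s) y)‖ ^ 2) s)) :
    ENNReal.ofReal g * volume X ≤
      (ENNReal.ofReal ((Real.exp (3 * γ * S) - 1) / (3 * γ)) * volume N) ^ (1 / 2 : ℝ) *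
        (ENNReal.ofReal ((Real.exp (3 * γ * S) - 1) / (3 * γ)) *
          ∫⁻ z in N, ENNReal.ofReal (‖V z‖ ^ 2)) ^ (1 / 2 : ℝ) := by
  -- the two weights `w₁ = 1`, `w₂ = ‖V‖²`; measurability of the two label functions
  have hw₁ : Measurable fun _ : EuclideanSpace ℝ (Fin 3) => ENNReal.ofReal (1 : ℝ) := measurable_const
  have hw₂ : Measurable fun z : EuclideanSpace ℝ (Fin 3) => ENNReal.ofReal (‖V z‖ ^ 2) :=
    (hV.continuous.norm.pow 2).measurable.ennreal_ofReal
  have hFm := (measurable_indicator_stayTube (γ := γ) hV hK L hNm hw₁).lintegral_prod_right'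
    (ν := volume.restrict (Icc 0 S))
  have hHm := (measurable_indicator_stayTube (γ := γ) hV hK L hNm hw₂).lintegral_prod_right'
    (ν := volume.restrict (Icc 0 S))
  -- (1) per-label law in `ℝ≥0∞` + (2) Cauchy–Schwarz across labels; then (3) Tonelli with the Jacobian
  refine (mul_measure_le_rpow_mul_rpow hXm hFm hHm fun y hy => ?_).trans ?_
  · have h' := ENNReal.ofReal_le_ofReal (hlabel y hy)
    rw [ENNReal.ofReal_mul (Real.sqrt_nonneg _), Real.sqrt_eq_rpow, Real.sqrt_eq_rpow,
      ← ENNReal.ofReal_rpow_of_nonneg (integral_nonneg fun s => Set.indicator_nonneg (fun _ _ => zero_le_one) _)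
        (by norm_num),
      ← ENNReal.ofReal_rpow_of_nonneg (integral_nonneg fun s => Set.indicator_nonneg (fun _ _ => by positivity) _)
        (by norm_num),
      ofReal_integral_label_eq (γ := γ) hV hK hNm y S (w := fun _ => (1 : ℝ)) continuous_const
        (fun _ => zero_le_one),
      ofReal_integral_label_eq (γ := γ) hV hK hNm y S (w := fun z => ‖V z‖ ^ 2) (hV.continuous.norm.pow 2)
        (fun _ => by positivity)] at h'
    exact h'
  · calc _ ≤ (ENNReal.ofReal ((Real.exp (3 * γ * S) - 1) / (3 * γ)) * ∫⁻ z in N, ENNReal.ofReal (1 : ℝ)) ^ (1 / 2 : ℝ) *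
          (ENNReal.ofReal ((Real.exp (3 * γ * S) - 1) / (3 * γ)) *
            ∫⁻ z in N, ENNReal.ofReal (‖V z‖ ^ 2)) ^ (1 / 2 : ℝ) := by
          gcongr
          · exact lintegral_labels_le (γ := γ) hV hK hγ hdiv hNm hw₁ X hS
          · exact lintegral_labels_le (γ := γ) hV hK hγ hdiv hNm hw₂ X hS
      _ = _ := by rw [ENNReal.ofReal_one, setLIntegral_one]

end Summit.NavierStokesRegularity.NavierStokesRegularity.Theorems.PowerGaugeEulerLiouville.NeedleFeeding
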